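/-
Copyright (c) 2026 the pub-hodgecm-mathlib formalisation cell (harness21).  Prover seat hodgecm-mathlib-F0P3a-p04 (g19): road «S3-ram» (LEAD F0P3a-plan (g12∕g13); junction
pen F0P3a-p01 (g17), J-PACK v2-iso; owner F0P3a-p06 (g15)); 2026-09-02.
-/
import Literature.NumberTheory.Automorphic.UnitaryLatticeTreeFixedChildSameLevelRamified    -- ★ p847581 (this seat): trace obstruction `not_map_toLin'_latt_le_scaleLattice_of_v_trace`
import HarnessLib

/-!
# The lattice graph of a hermitian space — «NOBODY IS DEEPER THAN `d₀`»: in the isoceles configuration every vertex has level at most `ϖ^{d₀}` under `γ − 1`, and the root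
# has level exactly `ϖ^{d₀}` (Kottwitz 1986 §3; Rogawski 1990 §4.9; Serre, *Trees* II.1.1)

Topic `NumberTheory/Automorphic`; namespace `Literature.NumberTheory.Automorphic.UnitaryLatticeTree`.  THEOREMS ONLY (no definition, no instance, no notation, no named fact,
no `sorry`); kernel lane `--supports stmt-HodgeConjecture-24833`.  Cell `pub/hodgecm-mathlib` (D-0151), crux H413; road «S3-ram» (Literature seeding, count-neutral); the
(a2) JUNCTION of the type-(1) ramified row, second wave J-PACK v2-iso (pen F0P3a-p01 (g17), skeleton v4∕v5; ISO-ROWS proposal §0 of F0P3a-p02 (g17): the root region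
`R = {v ∈ Fix | SD v ∧ LEV[v](ϖ^{d₀})}` is the TOP level — «nobody deeper than `d₀`»).

ISOCELES EIGEN-DATA (the skeleton's binders): `γ = A·diag(s)·A⁻¹` (`A ∈ GL₃`, for the level bound not even integral), `s 1 = 1`, an ISOLATED index `i₀` with
`|s_{i₀} − s_j| = |ϖ|^{d₀}` for `j ≠ i₀` and a CLOSE pair `|s_j − s_k| ≤ |ϖ|^{d₀+2}` (`j, k ≠ i₀`), `|2| = 1`.  Then `tr(γ − 1) = Σ_i (s_i − 1) = (s₀ − 1) + (s₂ − 1)`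
has EXACT size `|ϖ|^{d₀}` (§1: in each of the three positions of `i₀` one summand or `2·`one summand dominates), so by the ★ TRACE OBSTRUCTION
(`not_map_toLin'_latt_le_scaleLattice_of_v_trace`: `tr(G⁻¹YG) = tr Y` is bounded by the level) NO lattice `latt G` — in particular no vertex of the graph, fixed or not —
satisfies `(γ−1)·M ⊆ ϖ^{d₀+1}·M` (§2).  Hence in the junction's
depth encoding `dep w = Nat.findGreatest (LEV[w](ϖ^·)) d₀` the cap is never artificial, `r₀ ∈ R`, and `R` is the set of vertices of MAXIMAL level.
(The equilateral configuration is different: there `s₀ − 1` and `s₂ − 1` may cancel in the trace; ★ `UnitaryLatticeTreeEquilateralRootRegionAntidiagonal` (F0P3a-p05) handles it.)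

* §1 **`v_trace_coe_sub_one_eq_of_isoceles`** (`|tr(γ − 1)| = |ϖ|^{d₀}`).
* §2 **`not_map_sub_one_le_scaleLattice_pow_succ_of_isoceles`** (every vertex: `¬LEV(ϖ^{d₀+1})`); the complementary root token `LEV[r₀](ϖ^{d₀})` is ★
  `map_sub_one_stdLattice_le_scaleLattice_of_eigenframe` (F0P3-p04, `UnitaryLatticeTreeRegionUpClosedRamified`).

HONEST LABEL: HC_CM is proved only modulo the 2 remaining named inputs (hLiu418 24832, h413 24833) until rung 0 closes; nothing printed is asserted here (elementary algebra
over a valuation ring); «S3-ram» has no books consequence.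

## References
* [Kottwitz1986] R. E. Kottwitz, *Base change for unit elements of Hecke algebras*, Compositio Math. 60 (1986), §3 (levels of fixed lattices; shell recursion).
* [Rogawski1990] J. D. Rogawski, *Automorphic Representations of Unitary Groups in Three Variables*, Ann. of Math. Stud. 123 (1990), §4.9 pp. 54–56 (the two configurations
  of a type-(1) torus at a ramified place).
* [Serre1980Trees] J.-P. Serre, *Trees* (1980), Ch. II §1.1–1.2 (lattices, neighbours, levels).
* [BruhatTits1972] F. Bruhat, J. Tits, *Groupes réductifs sur un corps local I*, Publ. Math. IHÉS 41 (1972), §10 (lattice models).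
-/

set_option autoImplicit false

noncomputable section

open scoped Valued WithZero Matrix MatrixGroups

namespace Literature.NumberTheory.Automorphic.UnitaryLatticeTree

open Literature.NumberTheory.Automorphic Literature.NumberTheory.Automorphic.HermitianLattice

variable {K : Type*} [Field K] [Valued K ℤᵐ⁰] {σ : K →+* K} {ϖ : K}

/-! ## §1 The trace of `γ − 1` in the isoceles configuration -/

/-- **`|tr(γ − 1)| = |ϖ|^{d₀}` in the ISOCELES configuration**: `γ = A·diag(s)·A⁻¹`, `s 1 = 1`, isolated index `i₀` (`|s_{i₀} − s_j| = |ϖ|^{d₀}`, `j ≠ i₀`), close pair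
(`|s_j − s_k| ≤ |ϖ|^{d₀+2}`, `j, k ≠ i₀`), `|2| = 1`: the trace `(s₀ − 1) + (s₂ − 1)` is dominated by one summand (`i₀ ∈ {0, 2}`) or equals `2(s₀ − 1) + O(ϖ^{d₀+2})` (`i₀ = 1`).
[cite: Rogawski1990, §4.9 pp. 54–56] [cite: Kottwitz1986, §3] -/
theorem v_trace_coe_sub_one_eq_of_isoceles (hϖ : Valued.v ϖ = WithZero.exp (-1 : ℤ)) (h2 : Valued.v (2 : K) = 1)
    {γ : unitaryGroupOfForm σ ((StdForm.antidiagonal 3).over K)} (A : GL (Fin 3) K) (s : Fin 3 → K) (hs1 : s 1 = 1)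
    (hγA : ((γ : GL (Fin 3) K) : Matrix (Fin 3) (Fin 3) K) = (A : Matrix (Fin 3) (Fin 3) K) * Matrix.diagonal s * ((A⁻¹ : GL (Fin 3) K) : Matrix (Fin 3) (Fin 3) K))
    (i₀ : Fin 3) {d₀ : ℕ} (hiso : ∀ j, j ≠ i₀ → Valued.v (s i₀ - s j) = Valued.v ϖ ^ d₀) (hclose : ∀ j k, j ≠ i₀ → k ≠ i₀ → Valued.v (s j - s k) ≤ Valued.v ϖ ^ (d₀ + 2)) :
    Valued.v ((((γ : GL (Fin 3) K) : Matrix (Fin 3) (Fin 3) K) - 1).trace) = Valued.v ϖ ^ d₀ := by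
  have hϖ0 : ϖ ≠ 0 := fun h0 => by rw [h0, map_zero] at hϖ; exact WithZero.coe_ne_zero hϖ.symm
  have hvϖ0 : Valued.v ϖ ≠ 0 := (Valuation.ne_zero_iff _).2 hϖ0
  have hϖlt : Valued.v ϖ < 1 := by rw [hϖ, ← WithZero.exp_zero]; exact WithZero.exp_lt_exp.2 (by norm_num)
  set e : Fin 3 → K := fun i => s i - 1 with hedef
  -- an index of the close pair, and the eigen-data in `e`-terms
  obtain ⟨j, hji⟩ := exists_ne i₀
  have hej : ∀ k l, e k - e l = s k - s l := fun k l => by simp only [hedef]; ring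
  have hiso' : Valued.v (e i₀ - e j) = Valued.v ϖ ^ d₀ := by rw [hej]; exact hiso j hji
  have hclose' : ∀ k, k ≠ i₀ → Valued.v (e k - e j) ≤ Valued.v ϖ ^ (d₀ + 2) := fun k hk => by rw [hej]; exact hclose k j hk hji
  have hkey : ∀ x y : K, Valued.v x = Valued.v ϖ ^ d₀ → Valued.v y ≤ Valued.v ϖ ^ (d₀ + 2) → Valued.v (x + y) = Valued.v ϖ ^ d₀ := by
    intro x y hx hy
    have hlt : Valued.v y < Valued.v x := by
      rw [hx]; refine hy.trans_lt ?_
      rw [pow_add]; exact mul_lt_of_lt_one_right (pow_pos (zero_lt_iff.2 hvϖ0) _) (pow_lt_one₀ zero_le hϖlt two_ne_zero)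
    rw [Valuation.map_add_eq_of_lt_left _ hlt, hx]
  have htr : Valued.v ((((γ : GL (Fin 3) K) : Matrix (Fin 3) (Fin 3) K) - 1).trace) = Valued.v ϖ ^ d₀ := by
    have htr1 : ((((γ : GL (Fin 3) K) : Matrix (Fin 3) (Fin 3) K) - 1).trace) = e 0 + e 2 := by
      have hAA : (A : Matrix (Fin 3) (Fin 3) K) * ((A⁻¹ : GL (Fin 3) K) : Matrix (Fin 3) (Fin 3) K) = 1 := by rw [← Units.val_mul, mul_inv_cancel, Units.val_one]
      have hdiag : ((γ : GL (Fin 3) K) : Matrix (Fin 3) (Fin 3) K) - 1 = (A : Matrix (Fin 3) (Fin 3) K) * Matrix.diagonal e * ((A⁻¹ : GL (Fin 3) K) : Matrix (Fin 3) (Fin 3) K) := by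
        have hd' : Matrix.diagonal e = Matrix.diagonal s - 1 := by rw [hedef, ← Matrix.diagonal_one, Matrix.diagonal_sub]
        rw [hγA, hd', Matrix.mul_sub, Matrix.sub_mul, Matrix.mul_one, hAA]
      rw [hdiag, Matrix.trace_mul_cycle, ← Units.val_mul, inv_mul_cancel, Units.val_one, Matrix.one_mul, Matrix.trace_diagonal, Fin.sum_univ_three]
      simp only [hedef, hs1, sub_self, add_zero]
    rw [htr1]
    have key : ∀ i₀ j : Fin 3, j ≠ i₀ → (i₀ = 1 ∧ j = 0) ∨ (i₀ = 1 ∧ j = 2) ∨ (i₀ = 0 ∧ j = 1) ∨ (i₀ = 2 ∧ j = 1) ∨ (i₀ = 0 ∧ j = 2) ∨ (i₀ = 2 ∧ j = 0) := by decide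
    have he1 : e 1 = 0 := by simp only [hedef, hs1, sub_self]
    rcases key i₀ j hji with ⟨rfl, rfl⟩ | ⟨rfl, rfl⟩ | ⟨rfl, rfl⟩ | ⟨rfl, rfl⟩ | ⟨rfl, rfl⟩ | ⟨rfl, rfl⟩
    · -- `u` isolated, `j = 0`: `e₀ + e₂ = 2e₀ + (e₂ − e₀)`
      have hx : Valued.v (2 * e 0) = Valued.v ϖ ^ d₀ := by
        rw [map_mul, h2, one_mul, ← Valuation.map_neg _ (e 0), show -e 0 = e 1 - e 0 by rw [he1, zero_sub]]; exact hiso'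
      rw [show e 0 + e 2 = 2 * e 0 + (e 2 - e 0) by ring]; exact hkey _ _ hx (hclose' 2 (by decide))
    · have hx : Valued.v (2 * e 2) = Valued.v ϖ ^ d₀ := by
        rw [map_mul, h2, one_mul, ← Valuation.map_neg _ (e 2), show -e 2 = e 1 - e 2 by rw [he1, zero_sub]]; exact hiso'
      rw [show e 0 + e 2 = 2 * e 2 + (e 0 - e 2) by ring]; exact hkey _ _ hx (hclose' 0 (by decide))
    · have hx : Valued.v (e 0) = Valued.v ϖ ^ d₀ := by rw [show e 0 = e 0 - e 1 by rw [he1, sub_zero]]; exact hiso'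
      exact hkey _ _ hx (by rw [show e 2 = e 2 - e 1 by rw [he1, sub_zero]]; exact hclose' 2 (by decide))
    · have hx : Valued.v (e 2) = Valued.v ϖ ^ d₀ := by rw [show e 2 = e 2 - e 1 by rw [he1, sub_zero]]; exact hiso'
      rw [add_comm]; exact hkey _ _ hx (by rw [show e 0 = e 0 - e 1 by rw [he1, sub_zero]]; exact hclose' 0 (by decide))
    · have hy : Valued.v (2 * e 2) ≤ Valued.v ϖ ^ (d₀ + 2) := by
        rw [map_mul, h2, one_mul, ← Valuation.map_neg _ (e 2), show -e 2 = e 1 - e 2 by rw [he1, zero_sub]]; exact hclose' 1 (by decide)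
      rw [show e 0 + e 2 = (e 0 - e 2) + 2 * e 2 by ring]; exact hkey _ _ hiso' hy
    · have hy : Valued.v (2 * e 0) ≤ Valued.v ϖ ^ (d₀ + 2) := by
        rw [map_mul, h2, one_mul, ← Valuation.map_neg _ (e 0), show -e 0 = e 1 - e 0 by rw [he1, zero_sub]]; exact hclose' 1 (by decide)
      rw [show e 0 + e 2 = (e 2 - e 0) + 2 * e 0 by ring]; exact hkey _ _ hiso' hy
  exact htr

/-! ## §2 Nobody is deeper than `d₀` -/

/-- **«NOBODY IS DEEPER THAN `d₀`»** (isoceles configuration): for EVERY vertex `w` of the lattice graph (fixed or not, self-dual or not),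
`¬ (γ−1)·w ⊆ ϖ^{d₀+1}·w` — the ★ trace obstruction with §1.  So the junction's depth cap `B = d₀` is never artificial and the root region
`R = {LEV(ϖ^{d₀})}` is the top level. [cite: Kottwitz1986, §3] [cite: Rogawski1990, §4.9 pp. 54–56] [cite: Serre1980Trees, II.1.1] -/
theorem not_map_sub_one_le_scaleLattice_pow_succ_of_isoceles (hϖ : Valued.v ϖ = WithZero.exp (-1 : ℤ)) (h2 : Valued.v (2 : K) = 1)
    {γ : unitaryGroupOfForm σ ((StdForm.antidiagonal 3).over K)} (A : GL (Fin 3) K) (s : Fin 3 → K) (hs1 : s 1 = 1)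
    (hγA : ((γ : GL (Fin 3) K) : Matrix (Fin 3) (Fin 3) K) = (A : Matrix (Fin 3) (Fin 3) K) * Matrix.diagonal s * ((A⁻¹ : GL (Fin 3) K) : Matrix (Fin 3) (Fin 3) K))
    (i₀ : Fin 3) {d₀ : ℕ} (hiso : ∀ j, j ≠ i₀ → Valued.v (s i₀ - s j) = Valued.v ϖ ^ d₀) (hclose : ∀ j k, j ≠ i₀ → k ≠ i₀ → Valued.v (s j - s k) ≤ Valued.v ϖ ^ (d₀ + 2))
    (w : {M : Submodule 𝒪[K] (Fin 3 → K) // IsVertex σ ϖ ((StdForm.antidiagonal 3).over K) M}) :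
    ¬ w.1.map ((Matrix.toLin' (((γ : GL (Fin 3) K) : Matrix (Fin 3) (Fin 3) K) - 1)).restrictScalars 𝒪[K]) ≤ scaleLattice (ϖ ^ (d₀ + 1)) w.1 := by
  obtain ⟨d, g, hwg, -, -, -⟩ := w.2
  rw [hwg]
  exact not_map_toLin'_latt_le_scaleLattice_of_v_trace hϖ (Matrix.isUnits_det_units g) _ (v_trace_coe_sub_one_eq_of_isoceles hϖ h2 A s hs1 hγA i₀ hiso hclose)

end Literature.NumberTheory.Automorphic.UnitaryLatticeTree

end
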